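import Summits.ABC.StewartYu.RecordExitsNumeric
import HarnessLib

/-!
# Cell abc-stewartyu, Gen-3 record: the MASTER polynomial-versus-exponential inequality behind exit B

`Summits/ABC/StewartYu/RecordExitsMaster.lean` — cell `abc-stewartyu` (HOME `run/shared/lean/pub/abc-stewartyu/`),
route `PadicPrimesKummerThird`, cruxes `Y07Odd` (stmt-ABC-19658) / `Y07Two` (stmt-ABC-19659); seat lp-1 (g2), record
parcel (R2).  Pure `ℕ`-arithmetic, theorems only.

Exit B of the END (Nesterenko's Lemma 5.4, `r = n`) for the parameter record `PadicG3Par` reduces — after the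
height case split of print ((5.18): largest height `A_{j*}` with `D_{j*} = 1`, or all `Dⱼ ≤ 2ρ/Aⱼ`) and the
cancellations `X ↔ 2X_fin`, `Ω ↔ ∏ 1/Aⱼ`, `K ↔ 2^Ŝ` — to ONE comparison of constants, uniformly in the four
sub-cases (`d₀ ∈ {0,1}` × the two height cases):

* `master` — `(n+1)!·n!·2^{n+3}·87ⁿ·(n+2)^{4n} ≤ 16^{n−1}·(n+1)^{n−1}·2^{n²+21n+2}` (`n ≥ 1`), where `87 > Cb = 32e`
  is the Siegel base of the record and `(n+2)^{4n}`, `16^{n−1}(n+1)^{n−1}` come from `S₀ = ⌊M/(n+2)⁴⌋`,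
  `M = 16(n+1)L`.

Proof: compare fourth powers with the elementary bounds `(n+1)⁴ ≤ 2^{n+6}`, `(n+2)⁸ ≤ 2^{n+19}`, `87⁴ ≤ 2^{26}`,
`k! ≤ kᵏ`; the exponent count is `4n² + 81n + 18 ≤ 4n² + 104n − 12` for `n ≥ 2`, and `n = 1` is checked directly.

WHAT THIS IS NOT: no parameter choice; no crux moves.

References: Yu. V. Nesterenko, LNM 1819 (2003), §5.2 Lemma 5.4, (5.18).
-/

open Nat

namespace Summit.ABC.StewartYu.RecordExitsNumeric

/-! ### Two more polynomial-versus-exponential facts -/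

/-- `(x+1)⁴ ≤ 2x⁴` for `x ≥ 6`. [folklore] -/
theorem succ_pow_four_le {x : ℕ} (hx : 6 ≤ x) : (x + 1) ^ 4 ≤ 2 * x ^ 4 := by
  have h3 : 6 * x ^ 3 ≤ x ^ 4 := by
    calc 6 * x ^ 3 ≤ x * x ^ 3 := Nat.mul_le_mul_right _ hx
      _ = x ^ 4 := by ring
  have h2 : 6 * x ^ 2 ≤ x ^ 3 := by
    calc 6 * x ^ 2 ≤ x * x ^ 2 := Nat.mul_le_mul_right _ hx
      _ = x ^ 3 := by ring
  have h1 : 6 * x ≤ x ^ 2 := by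
    calc 6 * x ≤ x * x := Nat.mul_le_mul_right _ hx
      _ = x ^ 2 := by ring
  calc (x + 1) ^ 4 = x ^ 4 + (4 * x ^ 3 + 6 * x ^ 2 + 4 * x + 1) := by ring
    _ ≤ x ^ 4 + x ^ 4 := by apply Nat.add_le_add_left; nlinarith
    _ = 2 * x ^ 4 := by ring

/-- **`(n+1)⁴ ≤ 2^{n+6}`** for every `n`. [folklore] -/
theorem succ_pow_four_le_two_pow (n : ℕ) : (n + 1) ^ 4 ≤ 2 ^ (n + 6) := by
  induction n with
  | zero => norm_num
  | succ k ih =>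
    by_cases hk : 5 ≤ k
    · calc (k + 1 + 1) ^ 4 ≤ 2 * (k + 1) ^ 4 := succ_pow_four_le (by omega)
        _ ≤ 2 * 2 ^ (k + 6) := Nat.mul_le_mul_left _ ih
        _ = 2 ^ (k + 1 + 6) := by ring
    · interval_cases k <;> norm_num

/-- `4(x+1)⁴ ≤ 5x⁴` for `x ≥ 18`. [folklore] -/
theorem four_mul_succ_pow_four_le {x : ℕ} (hx : 18 ≤ x) : 4 * (x + 1) ^ 4 ≤ 5 * x ^ 4 := by
  have h3 : 18 * x ^ 3 ≤ x ^ 4 := by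
    calc 18 * x ^ 3 ≤ x * x ^ 3 := Nat.mul_le_mul_right _ hx
      _ = x ^ 4 := by ring
  have h2 : 18 * x ^ 2 ≤ x ^ 3 := by
    calc 18 * x ^ 2 ≤ x * x ^ 2 := Nat.mul_le_mul_right _ hx
      _ = x ^ 3 := by ring
  have h1 : 18 * x ≤ x ^ 2 := by
    calc 18 * x ≤ x * x := Nat.mul_le_mul_right _ hx
      _ = x ^ 2 := by ring
  calc 4 * (x + 1) ^ 4 = 4 * x ^ 4 + (16 * x ^ 3 + 24 * x ^ 2 + 16 * x + 4) := by ring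
    _ ≤ 4 * x ^ 4 + x ^ 4 := by apply Nat.add_le_add_left; nlinarith
    _ = 5 * x ^ 4 := by ring

/-- `(x+1)⁸ ≤ 2x⁸` for `x ≥ 18`. [folklore] -/
theorem succ_pow_eight_le {x : ℕ} (hx : 18 ≤ x) : (x + 1) ^ 8 ≤ 2 * x ^ 8 := by
  have h := four_mul_succ_pow_four_le hx
  have h2 : 16 * (x + 1) ^ 8 ≤ 25 * x ^ 8 := by
    calc 16 * (x + 1) ^ 8 = (4 * (x + 1) ^ 4) * (4 * (x + 1) ^ 4) := by ring
      _ ≤ (5 * x ^ 4) * (5 * x ^ 4) := Nat.mul_le_mul h h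
      _ = 25 * x ^ 8 := by ring
  omega

/-- **`(n+2)⁸ ≤ 2^{n+19}`** for every `n`. [folklore] -/
theorem pow_eight_le_two_pow (n : ℕ) : (n + 2) ^ 8 ≤ 2 ^ (n + 19) := by
  induction n with
  | zero => norm_num
  | succ k ih =>
    by_cases hk : 16 ≤ k
    · calc (k + 1 + 2) ^ 8 = (k + 2 + 1) ^ 8 := by ring
        _ ≤ 2 * (k + 2) ^ 8 := succ_pow_eight_le (by omega)
        _ ≤ 2 * 2 ^ (k + 19) := Nat.mul_le_mul_left _ ih
        _ = 2 ^ (k + 1 + 19) := by ring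
    · interval_cases k <;> norm_num

/-! ### The master inequality -/

/-- **MASTER INEQUALITY** of the record's exit B: for `n ≥ 1`,
`(n+1)!·n!·2^{n+3}·87ⁿ·(n+2)^{4n} ≤ 16^{n−1}·(n+1)^{n−1}·2^{n²+21n+2}`.
[cite: Nesterenko2003, §5.2 Lemma 5.4 (the final numerical comparison)] -/
theorem master {n : ℕ} (hn : 1 ≤ n) :
    (n + 1)! * n ! * 2 ^ (n + 3) * 87 ^ n * (n + 2) ^ (4 * n) ≤
      16 ^ (n - 1) * (n + 1) ^ (n - 1) * 2 ^ (n ^ 2 + 21 * n + 2) := by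
  rcases Nat.lt_or_ge n 2 with h1 | h2
  · -- `n = 1`
    obtain rfl : n = 1 := by omega
    norm_num
  · -- `n ≥ 2`: compare fourth powers
    rw [← Nat.pow_le_pow_iff_left (by norm_num : (4 : ℕ) ≠ 0)]
    -- bounds for the factors of the left-hand side
    have hf1 : ((n + 1)!) ^ 4 ≤ 2 ^ ((n + 6) * (n + 1)) := by
      calc ((n + 1)!) ^ 4 ≤ ((n + 1) ^ (n + 1)) ^ 4 := Nat.pow_le_pow_left (Nat.factorial_le_pow _) 4
        _ = ((n + 1) ^ 4) ^ (n + 1) := by rw [← pow_mul, ← pow_mul, mul_comm]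
        _ ≤ (2 ^ (n + 6)) ^ (n + 1) := Nat.pow_le_pow_left (succ_pow_four_le_two_pow n) _
        _ = 2 ^ ((n + 6) * (n + 1)) := by rw [← pow_mul]
    have hf2 : (n !) ^ 4 ≤ 2 ^ ((n + 6) * n) := by
      calc (n !) ^ 4 ≤ (n ^ n) ^ 4 := Nat.pow_le_pow_left (Nat.factorial_le_pow _) 4
        _ ≤ ((n + 1) ^ n) ^ 4 := Nat.pow_le_pow_left (Nat.pow_le_pow_left (by omega) _) 4
        _ = ((n + 1) ^ 4) ^ n := by rw [← pow_mul, ← pow_mul, mul_comm]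
        _ ≤ (2 ^ (n + 6)) ^ n := Nat.pow_le_pow_left (succ_pow_four_le_two_pow n) _
        _ = 2 ^ ((n + 6) * n) := by rw [← pow_mul]
    have hf3 : (2 ^ (n + 3)) ^ 4 = 2 ^ (4 * n + 12) := by rw [← pow_mul]; ring_nf
    have hf4 : (87 ^ n) ^ 4 ≤ 2 ^ (26 * n) := by
      calc (87 ^ n) ^ 4 = (87 ^ 4) ^ n := by rw [← pow_mul, ← pow_mul, mul_comm]
        _ ≤ (2 ^ 26) ^ n := Nat.pow_le_pow_left (by norm_num) _
        _ = 2 ^ (26 * n) := by rw [← pow_mul]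
    have hf5 : ((n + 2) ^ (4 * n)) ^ 4 ≤ 2 ^ ((n + 19) * (2 * n)) := by
      calc ((n + 2) ^ (4 * n)) ^ 4 = ((n + 2) ^ 8) ^ (2 * n) := by rw [← pow_mul, ← pow_mul]; ring_nf
        _ ≤ (2 ^ (n + 19)) ^ (2 * n) := Nat.pow_le_pow_left (pow_eight_le_two_pow n) _
        _ = 2 ^ ((n + 19) * (2 * n)) := by rw [← pow_mul]
    -- the left-hand side
    have hL : ((n + 1)! * n ! * 2 ^ (n + 3) * 87 ^ n * (n + 2) ^ (4 * n)) ^ 4 ≤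
        2 ^ ((n + 6) * (n + 1) + (n + 6) * n + (4 * n + 12) + 26 * n + (n + 19) * (2 * n)) := by
      calc ((n + 1)! * n ! * 2 ^ (n + 3) * 87 ^ n * (n + 2) ^ (4 * n)) ^ 4
          = ((n + 1)!) ^ 4 * (n !) ^ 4 * (2 ^ (n + 3)) ^ 4 * (87 ^ n) ^ 4 * ((n + 2) ^ (4 * n)) ^ 4 := by
            simp only [mul_pow]
        _ ≤ 2 ^ ((n + 6) * (n + 1)) * 2 ^ ((n + 6) * n) * 2 ^ (4 * n + 12) * 2 ^ (26 * n) *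
              2 ^ ((n + 19) * (2 * n)) :=
            Nat.mul_le_mul (Nat.mul_le_mul (Nat.mul_le_mul (Nat.mul_le_mul hf1 hf2) hf3.le) hf4) hf5
        _ = 2 ^ ((n + 6) * (n + 1) + (n + 6) * n + (4 * n + 12) + 26 * n + (n + 19) * (2 * n)) := by
            simp only [← pow_add]
    -- the right-hand side
    have hR : 2 ^ (20 * (n - 1) + 4 * (n ^ 2 + 21 * n + 2)) ≤
        (16 ^ (n - 1) * (n + 1) ^ (n - 1) * 2 ^ (n ^ 2 + 21 * n + 2)) ^ 4 := by
      rw [mul_pow, mul_pow, ← pow_mul, ← pow_mul, ← pow_mul, pow_add]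
      have e16 : (16 : ℕ) ^ ((n - 1) * 4) = 2 ^ (16 * (n - 1)) := by
        rw [show (16 : ℕ) = 2 ^ 4 by norm_num, ← pow_mul]; ring_nf
      have h2 : 2 ^ (4 * (n - 1)) ≤ (n + 1) ^ ((n - 1) * 4) := by
        calc 2 ^ (4 * (n - 1)) = (2 ^ (n - 1)) ^ 4 := by rw [← pow_mul, mul_comm]
          _ ≤ ((n + 1) ^ (n - 1)) ^ 4 := Nat.pow_le_pow_left (Nat.pow_le_pow_left (by omega) _) 4
          _ = (n + 1) ^ ((n - 1) * 4) := by rw [← pow_mul]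
      calc 2 ^ (20 * (n - 1)) * 2 ^ (4 * (n ^ 2 + 21 * n + 2))
          = 2 ^ (16 * (n - 1)) * 2 ^ (4 * (n - 1)) * 2 ^ ((n ^ 2 + 21 * n + 2) * 4) := by
            rw [← pow_add, ← pow_add, ← pow_add]; ring_nf
        _ ≤ 16 ^ ((n - 1) * 4) * (n + 1) ^ ((n - 1) * 4) * 2 ^ ((n ^ 2 + 21 * n + 2) * 4) := by
            rw [e16]; gcongr
    -- exponent comparison: `4n² + 81n + 18 ≤ 4n² + 104n − 12` for `n ≥ 2`
    refine hL.trans (le_trans ?_ hR)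
    apply Nat.pow_le_pow_right (by norm_num)
    have : n - 1 + 1 = n := Nat.sub_add_cancel hn
    nlinarith [this]

end Summit.ABC.StewartYu.RecordExitsNumeric
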